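/-
Copyright: harness cell b2b-lgcu-borel (gen 26).  Honest framing: the VALUE here is a THEOREM
(a decidable NEGATIVE verdict on an infinite slice of the crux: all subgroup triples of
`GL_3(𝔽_p)`, `p ∈ {23, 29, 31, 37}`, below an explicit `ε`) — NOT summit progress; the crux item
`SubgroupIdentityDesigns` (stmt-MatrixMultiplication-14079) stays open and untouched.
-/
import Mathlib
import Literature.Barriers.RiemannHypothesis.EpsteinZetaRealZerosIntegralWitness
import Summits.MatrixMultiplication.MatrixMultiplication.Theorems.SubgroupIdentityDesigns.Negative.LevelOneEpsilonFloor

/-!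
# The `ε`-window of the level-one cells `(m, p) = (3, 23), (3, 29), (3, 31), (3, 37)`

Route `LevelGradedCohnUmans`, crux `SubgroupIdentityDesigns`, negative side; level `k = 1`.
Sequel of `LevelOneEpsilonCells` (cells `p = 11, 13, 17, 19`), same mechanism: the general-exponent
floor `LevelOneEpsilonFloor.floor_exp` (`1 + (b−1)^t + (p−2) b^t < V^{t/3}` for every `t ≥ 2 + ε`)
against the volume law `V + u²(u−1) ≤ uD` of `WitnessNeumannCounts.crux_volume_law`.

* `cert_twentythree`, …, `cert_thirtyseven` : pure arithmetic certificates by `norm_num`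
  (generated and checked exactly by `code/g26/lean/gen_cells2.py`);
* `no_levelOne_witness_three_twentythree` : **at `(m, p) = (3, 23)` NO subgroup-TPP triple with a
  level-one identity design satisfies the crux inequality for ANY `−2 < ε ≤ 1/2`** (`t = 5/2`;
  `V ≤ 6 717 313 624` against the floor `≈ 6.902·10⁹`, margin 2.75 %; reach `ε* ≈ 0.518`);
* `no_levelOne_witness_three_twentynine` / `_thirtyone` / `_thirtyseven` : `(3, 29)`, `(3, 31)`,
  `(3, 37)` for `−2 < ε ≤ 2/5` (`t = 12/5`; margins 12.9 %, 11.0 %, 6.1 %; reach `ε* ≈ 0.472`,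
  `0.460`, `≈ 0.43`);
* `no_crux_instance_three_twentythree`, `no_crux_instance_three_twentynine_thirtyone_thirtyseven` :
  the crux clause verbatim at `m = 3`.

So these cells are open only in the windows `ε ∈ (1/2, 1]` (`p = 23`) and `(2/5, 1]`
(`p = 29, 31, 37`).  Sorry-free; standard axioms; no new definitions.  Report:
`run/shared/lean/b2b/levelgraded-cu/ORACLE-g26.md` §G26-2.
-/

set_option linter.dupNamespace false

noncomputable section

open scoped BigOperators Classical Matrix
open Module (finrank)

namespace Summit.MatrixMultiplication.MatrixMultiplication.Theorems.SubgroupIdentityDesigns.Negative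
namespace LevelOneEpsilonCellsTwo

open Literature.Barriers.MatrixMultiplication (SubgroupTPP)
open Summit.MatrixMultiplication.MatrixMultiplication.Theorems.LieRankDesigns.Negative
  (GLm Mat budget)
open Summit.MatrixMultiplication.MatrixMultiplication.Theorems.LevelOneGL2Designs.Negative
  (levelSubmodule)
open LevelOneFloorAll (finrank_le_formula_nat)
open WitnessNeumannCounts (crux_volume_law)
open LevelOneEpsilonFloor (floor_exp volume_cap quad_trichotomy volume_real cell_absurd)
-- root comparisons `c^n ≤ x^k ⇒ c ≤ x^{k/n}` (generic real-analysis helpers already in the tree)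
open Literature.Barriers.RiemannHypothesis (le_rpow_of_pow_le rpow_le_of_pow_le)

variable {p : ℕ} [hp : Fact p.Prime]

/-! ## The cell `(3, 23)`: no witness unless `ε > 1/2` -/

/-- Arithmetic certificate of the cell `(3, 23)`: `D ≤ 6726694`, volume cap `V ≤ 6717313624`
(`u = 1498`), floor exponent `t = 5/2`: `7158923 ≤ 552^t`, `7191389 ≤ 553^t`,
`6717313624^(t/3) ≤ 158178093`. -/
theorem cert_twentythree {u D V : ℕ} (hu1 : 1 ≤ u) (hvol : V + u * u * (u - 1) ≤ u * D)
    (hD : D + 2 * 553 ≤ (23 - 1) * 553 ^ 2 + 2)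
    (hfl : 1 + (((553 : ℕ) : ℝ) - 1) ^ ((5 : ℝ) / 2) +
      (((23 : ℕ) : ℝ) - 2) * ((553 : ℕ) : ℝ) ^ ((5 : ℝ) / 2) <
      ((V : ℕ) : ℝ) ^ ((5 : ℝ) / 2 / 3)) : False := by
  have hDm : D ≤ 6726694 := by norm_num at hD; omega
  obtain ⟨w, hw⟩ := volume_real hu1 hvol hDm
  have hw0 : (0 : ℝ) ≤ w := Nat.cast_nonneg _
  have hq := quad_trichotomy (w := w) (w₀ := 1497) (D := ((6726694 : ℕ) : ℝ)) (by norm_num)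
    (by norm_num)
  have hcap := volume_cap (w₀ := ((1497 : ℕ) : ℝ)) hw0 hw le_rfl hq
  have hVM : ((V : ℕ) : ℝ) ≤ 6717313624 := by norm_num at hcap; exact_mod_cast hcap
  have e1 : (((553 : ℕ) : ℝ) - 1) = 552 := by norm_num
  have e2 : (((23 : ℕ) : ℝ) - 2) = 21 := by norm_num
  have e3 : (((553 : ℕ) : ℝ)) = 553 := by norm_num
  have e4 : ((5 : ℝ) / 2 / 3) = (5 : ℝ) / 6 := by norm_num
  rw [e1, e2, e3, e4] at hfl
  have h2 : (7158923 : ℝ) ≤ (552 : ℝ) ^ ((5 : ℝ) / 2) :=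
    le_rpow_of_pow_le (k := 5) (n := 2) (by norm_num) (by norm_num) (by norm_num)
      (by norm_num) (by norm_num)
  have h1 : (7191389 : ℝ) ≤ (553 : ℝ) ^ ((5 : ℝ) / 2) :=
    le_rpow_of_pow_le (k := 5) (n := 2) (by norm_num) (by norm_num) (by norm_num)
      (by norm_num) (by norm_num)
  have hM : (6717313624 : ℝ) ^ ((5 : ℝ) / 6) ≤ 1 + 7158923 + 21 * 7191389 :=
    rpow_le_of_pow_le (k := 5) (n := 6) (by norm_num) (by norm_num) (by norm_num)
      (by norm_num) (by norm_num)
  exact cell_absurd (Nat.cast_nonneg V) hVM (by norm_num) (by norm_num) hfl h2 h1 hM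

/-- **NO LEVEL-ONE WITNESS AT `(m, p) = (3, 23)` FOR `−2 < ε ≤ 1/2`** (all subgroup triples; TPP and
a level-one identity design only feed the volume law). -/
theorem no_levelOne_witness_three_twentythree (hp' : p = 23) {ε : ℝ} (hε : -2 < ε) (hε1 : ε ≤ 1 / 2)
    {H₁ H₂ H₃ : Subgroup (GLm p (1 + 2))} (htpp : SubgroupTPP H₁ H₂ H₃)
    (hdes : ∃ c : Mat p (1 + 2) → ℂ, (∀ M, 1 < M.rank → c M = 0) ∧
      (∑ M, c M * ZMod.stdAddChar (Matrix.trace (M * ((1 : GLm p (1 + 2)) : Mat p (1 + 2))))) = 1 ∧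
      ∀ a ∈ H₁, ∀ b ∈ H₂, ∀ g ∈ H₃, a * b * g ≠ 1 →
        (∑ M, c M * ZMod.stdAddChar
          (Matrix.trace (M * ((a * b * g : GLm p (1 + 2)) : Mat p (1 + 2))))) = 0) :
    ¬ budget p (1 + 2) 1 (2 + ε) <
      ((Nat.card H₁ * Nat.card H₂ * Nat.card H₃ : ℕ) : ℝ) ^ ((2 + ε) / 3) := by
  intro hlt
  subst hp'
  obtain ⟨u, hu1, -, -, -, -, hvol⟩ := crux_volume_law (k := 1) htpp hdes
  have hfl := floor_exp (p := 23) (l := 2) (t := (5 : ℝ) / 2) (by omega) hε (by linarith) hlt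
  have hD := finrank_le_formula_nat (p := 23) (l := 2)
  have hb : (23 ^ (1 + 2) - 1) / (23 - 1) = 553 := by norm_num
  rw [hb] at hfl hD
  generalize finrank ℂ (levelSubmodule 23 (1 + 2) 1) = D at hD hvol
  generalize Nat.card H₁ * Nat.card H₂ * Nat.card H₃ = V at hfl hvol
  exact cert_twentythree hu1 hvol hD hfl

/-! ## The cells `(3, 29)`, `(3, 31)`, `(3, 37)`: no witness unless `ε > 2/5` -/

/-- Arithmetic certificate of the cell `(3, 29)`: `D ≤ 21240208`, volume cap `V ≤ 37684943628`
(`u = 2661`), floor exponent `t = 12/5`: `11346089 ≤ 870^t`, `11377414 ≤ 871^t`,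
`37684943628^(t/3) ≤ 318536268`. -/
theorem cert_twentynine {u D V : ℕ} (hu1 : 1 ≤ u) (hvol : V + u * u * (u - 1) ≤ u * D)
    (hD : D + 2 * 871 ≤ (29 - 1) * 871 ^ 2 + 2)
    (hfl : 1 + (((871 : ℕ) : ℝ) - 1) ^ ((12 : ℝ) / 5) +
      (((29 : ℕ) : ℝ) - 2) * ((871 : ℕ) : ℝ) ^ ((12 : ℝ) / 5) <
      ((V : ℕ) : ℝ) ^ ((12 : ℝ) / 5 / 3)) : False := by
  have hDm : D ≤ 21240208 := by norm_num at hD; omega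
  obtain ⟨w, hw⟩ := volume_real hu1 hvol hDm
  have hw0 : (0 : ℝ) ≤ w := Nat.cast_nonneg _
  have hq := quad_trichotomy (w := w) (w₀ := 2660) (D := ((21240208 : ℕ) : ℝ)) (by norm_num)
    (by norm_num)
  have hcap := volume_cap (w₀ := ((2660 : ℕ) : ℝ)) hw0 hw le_rfl hq
  have hVM : ((V : ℕ) : ℝ) ≤ 37684943628 := by norm_num at hcap; exact_mod_cast hcap
  have e1 : (((871 : ℕ) : ℝ) - 1) = 870 := by norm_num
  have e2 : (((29 : ℕ) : ℝ) - 2) = 27 := by norm_num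
  have e3 : (((871 : ℕ) : ℝ)) = 871 := by norm_num
  have e4 : ((12 : ℝ) / 5 / 3) = (12 : ℝ) / 15 := by norm_num
  rw [e1, e2, e3, e4] at hfl
  have h2 : (11346089 : ℝ) ≤ (870 : ℝ) ^ ((12 : ℝ) / 5) :=
    le_rpow_of_pow_le (k := 12) (n := 5) (by norm_num) (by norm_num) (by norm_num)
      (by norm_num) (by norm_num)
  have h1 : (11377414 : ℝ) ≤ (871 : ℝ) ^ ((12 : ℝ) / 5) :=
    le_rpow_of_pow_le (k := 12) (n := 5) (by norm_num) (by norm_num) (by norm_num)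
      (by norm_num) (by norm_num)
  have hM : (37684943628 : ℝ) ^ ((12 : ℝ) / 15) ≤ 1 + 11346089 + 27 * 11377414 :=
    rpow_le_of_pow_le (k := 12) (n := 15) (by norm_num) (by norm_num) (by norm_num)
      (by norm_num) (by norm_num)
  exact cell_absurd (Nat.cast_nonneg V) hVM (by norm_num) (by norm_num) hfl h2 h1 hM

/-- **NO LEVEL-ONE WITNESS AT `(m, p) = (3, 29)` FOR `−2 < ε ≤ 2/5`** (all subgroup triples; TPP and
a level-one identity design only feed the volume law). -/
theorem no_levelOne_witness_three_twentynine (hp' : p = 29) {ε : ℝ} (hε : -2 < ε) (hε1 : ε ≤ 2 / 5)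
    {H₁ H₂ H₃ : Subgroup (GLm p (1 + 2))} (htpp : SubgroupTPP H₁ H₂ H₃)
    (hdes : ∃ c : Mat p (1 + 2) → ℂ, (∀ M, 1 < M.rank → c M = 0) ∧
      (∑ M, c M * ZMod.stdAddChar (Matrix.trace (M * ((1 : GLm p (1 + 2)) : Mat p (1 + 2))))) = 1 ∧
      ∀ a ∈ H₁, ∀ b ∈ H₂, ∀ g ∈ H₃, a * b * g ≠ 1 →
        (∑ M, c M * ZMod.stdAddChar
          (Matrix.trace (M * ((a * b * g : GLm p (1 + 2)) : Mat p (1 + 2))))) = 0) :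
    ¬ budget p (1 + 2) 1 (2 + ε) <
      ((Nat.card H₁ * Nat.card H₂ * Nat.card H₃ : ℕ) : ℝ) ^ ((2 + ε) / 3) := by
  intro hlt
  subst hp'
  obtain ⟨u, hu1, -, -, -, -, hvol⟩ := crux_volume_law (k := 1) htpp hdes
  have hfl := floor_exp (p := 29) (l := 2) (t := (12 : ℝ) / 5) (by omega) hε (by linarith) hlt
  have hD := finrank_le_formula_nat (p := 29) (l := 2)
  have hb : (29 ^ (1 + 2) - 1) / (29 - 1) = 871 := by norm_num
  rw [hb] at hfl hD
  generalize finrank ℂ (levelSubmodule 29 (1 + 2) 1) = D at hD hvol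
  generalize Nat.card H₁ * Nat.card H₂ * Nat.card H₃ = V at hfl hvol
  exact cert_twentynine hu1 hvol hD hfl

/-- Arithmetic certificate of the cell `(3, 31)`: `D ≤ 29579486`, volume cap `V ≤ 61930301640`
(`u = 3140`), floor exponent `t = 12/5`: `15546334 ≤ 992^t`, `15583973 ≤ 993^t`,
`61930301640^(t/3) ≤ 467481552`. -/
theorem cert_thirtyone {u D V : ℕ} (hu1 : 1 ≤ u) (hvol : V + u * u * (u - 1) ≤ u * D)
    (hD : D + 2 * 993 ≤ (31 - 1) * 993 ^ 2 + 2)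
    (hfl : 1 + (((993 : ℕ) : ℝ) - 1) ^ ((12 : ℝ) / 5) +
      (((31 : ℕ) : ℝ) - 2) * ((993 : ℕ) : ℝ) ^ ((12 : ℝ) / 5) <
      ((V : ℕ) : ℝ) ^ ((12 : ℝ) / 5 / 3)) : False := by
  have hDm : D ≤ 29579486 := by norm_num at hD; omega
  obtain ⟨w, hw⟩ := volume_real hu1 hvol hDm
  have hw0 : (0 : ℝ) ≤ w := Nat.cast_nonneg _
  have hq := quad_trichotomy (w := w) (w₀ := 3139) (D := ((29579486 : ℕ) : ℝ)) (by norm_num)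
    (by norm_num)
  have hcap := volume_cap (w₀ := ((3139 : ℕ) : ℝ)) hw0 hw le_rfl hq
  have hVM : ((V : ℕ) : ℝ) ≤ 61930301640 := by norm_num at hcap; exact_mod_cast hcap
  have e1 : (((993 : ℕ) : ℝ) - 1) = 992 := by norm_num
  have e2 : (((31 : ℕ) : ℝ) - 2) = 29 := by norm_num
  have e3 : (((993 : ℕ) : ℝ)) = 993 := by norm_num
  have e4 : ((12 : ℝ) / 5 / 3) = (12 : ℝ) / 15 := by norm_num
  rw [e1, e2, e3, e4] at hfl
  have h2 : (15546334 : ℝ) ≤ (992 : ℝ) ^ ((12 : ℝ) / 5) :=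
    le_rpow_of_pow_le (k := 12) (n := 5) (by norm_num) (by norm_num) (by norm_num)
      (by norm_num) (by norm_num)
  have h1 : (15583973 : ℝ) ≤ (993 : ℝ) ^ ((12 : ℝ) / 5) :=
    le_rpow_of_pow_le (k := 12) (n := 5) (by norm_num) (by norm_num) (by norm_num)
      (by norm_num) (by norm_num)
  have hM : (61930301640 : ℝ) ^ ((12 : ℝ) / 15) ≤ 1 + 15546334 + 29 * 15583973 :=
    rpow_le_of_pow_le (k := 12) (n := 15) (by norm_num) (by norm_num) (by norm_num)
      (by norm_num) (by norm_num)
  exact cell_absurd (Nat.cast_nonneg V) hVM (by norm_num) (by norm_num) hfl h2 h1 hM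

/-- **NO LEVEL-ONE WITNESS AT `(m, p) = (3, 31)` FOR `−2 < ε ≤ 2/5`** (all subgroup triples; TPP and
a level-one identity design only feed the volume law). -/
theorem no_levelOne_witness_three_thirtyone (hp' : p = 31) {ε : ℝ} (hε : -2 < ε) (hε1 : ε ≤ 2 / 5)
    {H₁ H₂ H₃ : Subgroup (GLm p (1 + 2))} (htpp : SubgroupTPP H₁ H₂ H₃)
    (hdes : ∃ c : Mat p (1 + 2) → ℂ, (∀ M, 1 < M.rank → c M = 0) ∧
      (∑ M, c M * ZMod.stdAddChar (Matrix.trace (M * ((1 : GLm p (1 + 2)) : Mat p (1 + 2))))) = 1 ∧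
      ∀ a ∈ H₁, ∀ b ∈ H₂, ∀ g ∈ H₃, a * b * g ≠ 1 →
        (∑ M, c M * ZMod.stdAddChar
          (Matrix.trace (M * ((a * b * g : GLm p (1 + 2)) : Mat p (1 + 2))))) = 0) :
    ¬ budget p (1 + 2) 1 (2 + ε) <
      ((Nat.card H₁ * Nat.card H₂ * Nat.card H₃ : ℕ) : ℝ) ^ ((2 + ε) / 3) := by
  intro hlt
  subst hp'
  obtain ⟨u, hu1, -, -, -, -, hvol⟩ := crux_volume_law (k := 1) htpp hdes
  have hfl := floor_exp (p := 31) (l := 2) (t := (12 : ℝ) / 5) (by omega) hε (by linarith) hlt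
  have hD := finrank_le_formula_nat (p := 31) (l := 2)
  have hb : (31 ^ (1 + 2) - 1) / (31 - 1) = 993 := by norm_num
  rw [hb] at hfl hD
  generalize finrank ℂ (levelSubmodule 31 (1 + 2) 1) = D at hD hvol
  generalize Nat.card H₁ * Nat.card H₂ * Nat.card H₃ = V at hfl hvol
  exact cert_thirtyone hu1 hvol hD hfl

/-- Arithmetic certificate of the cell `(3, 37)`: `D ≤ 71264552`, volume cap `V ≤ 231581042700`
(`u = 4874`), floor exponent `t = 12/5`: `35905813 ≤ 1406^t`, `35967134 ≤ 1407^t`,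
`231581042700^(t/3) ≤ 1294755504`. -/
theorem cert_thirtyseven {u D V : ℕ} (hu1 : 1 ≤ u) (hvol : V + u * u * (u - 1) ≤ u * D)
    (hD : D + 2 * 1407 ≤ (37 - 1) * 1407 ^ 2 + 2)
    (hfl : 1 + (((1407 : ℕ) : ℝ) - 1) ^ ((12 : ℝ) / 5) +
      (((37 : ℕ) : ℝ) - 2) * ((1407 : ℕ) : ℝ) ^ ((12 : ℝ) / 5) <
      ((V : ℕ) : ℝ) ^ ((12 : ℝ) / 5 / 3)) : False := by
  have hDm : D ≤ 71264552 := by norm_num at hD; omega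
  obtain ⟨w, hw⟩ := volume_real hu1 hvol hDm
  have hw0 : (0 : ℝ) ≤ w := Nat.cast_nonneg _
  have hq := quad_trichotomy (w := w) (w₀ := 4873) (D := ((71264552 : ℕ) : ℝ)) (by norm_num)
    (by norm_num)
  have hcap := volume_cap (w₀ := ((4873 : ℕ) : ℝ)) hw0 hw le_rfl hq
  have hVM : ((V : ℕ) : ℝ) ≤ 231581042700 := by norm_num at hcap; exact_mod_cast hcap
  have e1 : (((1407 : ℕ) : ℝ) - 1) = 1406 := by norm_num
  have e2 : (((37 : ℕ) : ℝ) - 2) = 35 := by norm_num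
  have e3 : (((1407 : ℕ) : ℝ)) = 1407 := by norm_num
  have e4 : ((12 : ℝ) / 5 / 3) = (12 : ℝ) / 15 := by norm_num
  rw [e1, e2, e3, e4] at hfl
  have h2 : (35905813 : ℝ) ≤ (1406 : ℝ) ^ ((12 : ℝ) / 5) :=
    le_rpow_of_pow_le (k := 12) (n := 5) (by norm_num) (by norm_num) (by norm_num)
      (by norm_num) (by norm_num)
  have h1 : (35967134 : ℝ) ≤ (1407 : ℝ) ^ ((12 : ℝ) / 5) :=
    le_rpow_of_pow_le (k := 12) (n := 5) (by norm_num) (by norm_num) (by norm_num)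
      (by norm_num) (by norm_num)
  have hM : (231581042700 : ℝ) ^ ((12 : ℝ) / 15) ≤ 1 + 35905813 + 35 * 35967134 :=
    rpow_le_of_pow_le (k := 12) (n := 15) (by norm_num) (by norm_num) (by norm_num)
      (by norm_num) (by norm_num)
  exact cell_absurd (Nat.cast_nonneg V) hVM (by norm_num) (by norm_num) hfl h2 h1 hM

/-- **NO LEVEL-ONE WITNESS AT `(m, p) = (3, 37)` FOR `−2 < ε ≤ 2/5`** (all subgroup triples; TPP and
a level-one identity design only feed the volume law). -/
theorem no_levelOne_witness_three_thirtyseven (hp' : p = 37) {ε : ℝ} (hε : -2 < ε) (hε1 : ε ≤ 2 / 5)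
    {H₁ H₂ H₃ : Subgroup (GLm p (1 + 2))} (htpp : SubgroupTPP H₁ H₂ H₃)
    (hdes : ∃ c : Mat p (1 + 2) → ℂ, (∀ M, 1 < M.rank → c M = 0) ∧
      (∑ M, c M * ZMod.stdAddChar (Matrix.trace (M * ((1 : GLm p (1 + 2)) : Mat p (1 + 2))))) = 1 ∧
      ∀ a ∈ H₁, ∀ b ∈ H₂, ∀ g ∈ H₃, a * b * g ≠ 1 →
        (∑ M, c M * ZMod.stdAddChar
          (Matrix.trace (M * ((a * b * g : GLm p (1 + 2)) : Mat p (1 + 2))))) = 0) :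
    ¬ budget p (1 + 2) 1 (2 + ε) <
      ((Nat.card H₁ * Nat.card H₂ * Nat.card H₃ : ℕ) : ℝ) ^ ((2 + ε) / 3) := by
  intro hlt
  subst hp'
  obtain ⟨u, hu1, -, -, -, -, hvol⟩ := crux_volume_law (k := 1) htpp hdes
  have hfl := floor_exp (p := 37) (l := 2) (t := (12 : ℝ) / 5) (by omega) hε (by linarith) hlt
  have hD := finrank_le_formula_nat (p := 37) (l := 2)
  have hb : (37 ^ (1 + 2) - 1) / (37 - 1) = 1407 := by norm_num
  rw [hb] at hfl hD
  generalize finrank ℂ (levelSubmodule 37 (1 + 2) 1) = D at hD hvol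
  generalize Nat.card H₁ * Nat.card H₂ * Nat.card H₃ = V at hfl hvol
  exact cert_thirtyseven hu1 hvol hD hfl

/-! ## The crux clause verbatim at `m = 3` -/

/-- **The crux clause verbatim has no level-one instance at `(m, p) = (3, 23)` for any
`−2 < ε ≤ 1/2`** — the cell is open only in the window `ε ∈ (1/2, 1]`. -/
theorem no_crux_instance_three_twentythree (hp' : p = 23) {ε : ℝ} (hε : -2 < ε)
    (hε1 : ε ≤ 1 / 2) :
    ¬ ∃ (H₁ H₂ H₃ : Subgroup (Matrix.GeneralLinearGroup (Fin 3) (ZMod p))),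
      Literature.Barriers.MatrixMultiplication.SubgroupTPP H₁ H₂ H₃ ∧
      (∃ c : Matrix (Fin 3) (Fin 3) (ZMod p) → ℂ, (∀ M, 1 < M.rank → c M = 0) ∧
        (∑ M : Matrix (Fin 3) (Fin 3) (ZMod p), c M * ZMod.stdAddChar
          (Matrix.trace (M * ((1 : Matrix.GeneralLinearGroup (Fin 3) (ZMod p)) :
            Matrix (Fin 3) (Fin 3) (ZMod p))))) = 1 ∧
        ∀ a ∈ H₁, ∀ b ∈ H₂, ∀ g ∈ H₃, a * b * g ≠ 1 →
          (∑ M : Matrix (Fin 3) (Fin 3) (ZMod p), c M * ZMod.stdAddChar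
            (Matrix.trace (M * ((a * b * g : Matrix.GeneralLinearGroup (Fin 3) (ZMod p)) :
              Matrix (Fin 3) (Fin 3) (ZMod p))))) = 0) ∧
      (∑ᶠ χ ∈ Literature.RepresentationTheory.FiniteGroups.irrChars
          (Matrix.GeneralLinearGroup (Fin 3) (ZMod p)) ∩
          {f | ∃ c : Matrix (Fin 3) (Fin 3) (ZMod p) → ℂ, (∀ M, 1 < M.rank → c M = 0) ∧
            ∀ g : Matrix.GeneralLinearGroup (Fin 3) (ZMod p), f g =
              ∑ M : Matrix (Fin 3) (Fin 3) (ZMod p), c M * ZMod.stdAddChar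
                (Matrix.trace (M * (g : Matrix (Fin 3) (Fin 3) (ZMod p))))},
        (χ 1).re ^ (2 + ε)) <
        ((Nat.card H₁ * Nat.card H₂ * Nat.card H₃ : ℕ) : ℝ) ^ ((2 + ε) / 3) := by
  rintro ⟨H₁, H₂, H₃, htpp, hdesign, hlt⟩
  exact no_levelOne_witness_three_twentythree hp' hε hε1 htpp hdesign hlt

/-- **The crux clause verbatim has no level-one instance at `(m, p) = (3, 29)`, `(3, 31)` or
`(3, 37)` for any `−2 < ε ≤ 2/5`.** -/
theorem no_crux_instance_three_twentynine_thirtyone_thirtyseven (hp' : p = 29 ∨ p = 31 ∨ p = 37)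
    {ε : ℝ} (hε : -2 < ε) (hε1 : ε ≤ 2 / 5) :
    ¬ ∃ (H₁ H₂ H₃ : Subgroup (Matrix.GeneralLinearGroup (Fin 3) (ZMod p))),
      Literature.Barriers.MatrixMultiplication.SubgroupTPP H₁ H₂ H₃ ∧
      (∃ c : Matrix (Fin 3) (Fin 3) (ZMod p) → ℂ, (∀ M, 1 < M.rank → c M = 0) ∧
        (∑ M : Matrix (Fin 3) (Fin 3) (ZMod p), c M * ZMod.stdAddChar
          (Matrix.trace (M * ((1 : Matrix.GeneralLinearGroup (Fin 3) (ZMod p)) :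
            Matrix (Fin 3) (Fin 3) (ZMod p))))) = 1 ∧
        ∀ a ∈ H₁, ∀ b ∈ H₂, ∀ g ∈ H₃, a * b * g ≠ 1 →
          (∑ M : Matrix (Fin 3) (Fin 3) (ZMod p), c M * ZMod.stdAddChar
            (Matrix.trace (M * ((a * b * g : Matrix.GeneralLinearGroup (Fin 3) (ZMod p)) :
              Matrix (Fin 3) (Fin 3) (ZMod p))))) = 0) ∧
      (∑ᶠ χ ∈ Literature.RepresentationTheory.FiniteGroups.irrChars
          (Matrix.GeneralLinearGroup (Fin 3) (ZMod p)) ∩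
          {f | ∃ c : Matrix (Fin 3) (Fin 3) (ZMod p) → ℂ, (∀ M, 1 < M.rank → c M = 0) ∧
            ∀ g : Matrix.GeneralLinearGroup (Fin 3) (ZMod p), f g =
              ∑ M : Matrix (Fin 3) (Fin 3) (ZMod p), c M * ZMod.stdAddChar
                (Matrix.trace (M * (g : Matrix (Fin 3) (Fin 3) (ZMod p))))},
        (χ 1).re ^ (2 + ε)) <
        ((Nat.card H₁ * Nat.card H₂ * Nat.card H₃ : ℕ) : ℝ) ^ ((2 + ε) / 3) := by
  rintro ⟨H₁, H₂, H₃, htpp, hdesign, hlt⟩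
  rcases hp' with h | h | h
  · exact no_levelOne_witness_three_twentynine h hε hε1 htpp hdesign hlt
  · exact no_levelOne_witness_three_thirtyone h hε hε1 htpp hdesign hlt
  · exact no_levelOne_witness_three_thirtyseven h hε hε1 htpp hdesign hlt

end LevelOneEpsilonCellsTwo

end Summit.MatrixMultiplication.MatrixMultiplication.Theorems.SubgroupIdentityDesigns.Negative
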